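import Summits.ValiantsHypothesis.ValiantsHypothesis.Theorems.BarrierLeverTransversalMinorLayoutsRankSeven
import Summits.ValiantsHypothesis.ValiantsHypothesis.Theorems.BarrierLeverTransversalMinorLayoutsClawsEight
import Summits.ValiantsHypothesis.ValiantsHypothesis.Theorems.BarrierLeverTransversalMinorLayoutsEightFacesSolid
import Summits.ValiantsHypothesis.ValiantsHypothesis.Theorems.BarrierLeverTransversalMinorLayoutsLockedCertsEightB

/-!
# Route BarrierLever — item `TransversalLayoutsRankLeEight` (stmt-ValiantsHypothesis-19933):
# the locked cells with eight faces at heights 6 and 5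

Helper file (`--supports stmt-ValiantsHypothesis-19933`; cell valiant-natproofs, rung V4, 𝒟-side of
door (c); seat val-np-p1 gen 8).  For eight rows the bounded engine
(`FiniteCheck.tt_rank_le_of_lockedCore`) leaves locked pairs of complexes at heights `4 … 7` with
one side using every coordinate.  Here the cells `(6, 8)` and `(5, 8)`: the full side is the claw
plus one edge, resp. plus two edges (`…ClawsEight`; degrees `1` and `2` occur on it), so the other
side has no vertex of degree one or two and is a SOLID TRIANGLE
(`lowerFamily_eight_no_degree_one_two`); the kernel certificates `claw6edge_v_simplex_h6_derivable`,
`matching5_v_simplex_h5_derivable`, `path3at5_v_simplex_h5_derivable` (`…LockedCertsEightB`)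
transport along coordinate relabelings (`good_of_ppDerivable_relabel`).

* `good_clawEdge_h6_r8` — cell `(6, 8)`;  * `good_twoEdges_h5_r8` — cell `(5, 8)`.

WHAT THIS IS NOT: two cells of a bounded-rank slice of TT; nothing on TT / item 19761 in general,
on crux stmt-ValiantsHypothesis-14610, or on `VP` versus `VNP`.
-/

-- layout Summits/ValiantsHypothesis/ValiantsHypothesis forces the duplicated namespace component
set_option linter.dupNamespace false

open Matrix Finset

namespace Summit.ValiantsHypothesis.ValiantsHypothesis.Theorems.BarrierLever.FiniteCheck

open Summit.ValiantsHypothesis.ValiantsHypothesis.Theorems.BarrierLever.Compression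
open Summit.ValiantsHypothesis.ValiantsHypothesis.Theorems.BarrierLever.PriorityPeeling

/-! ## 1. Tools: solid-triangle columns -/

/-- A subset of `{a, b, c}` relabeled by `π'` is a subset of `{π' a, π' b, π' c}`. -/
theorem map_subset_three {h : ℕ} (y : Finset (Fin h)) (a b c : Fin h) (π' : Equiv.Perm (Fin h))
    (hy : y ⊆ {a, b, c}) : y.map π'.toEmbedding ⊆ {π' a, π' b, π' c} := by
  intro z hz
  rw [Finset.mem_map_equiv] at hz
  have hz' := hy hz
  simp only [Finset.mem_insert, Finset.mem_singleton] at hz' ⊢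
  rcases hz' with e | e | e
  · exact Or.inl (by rw [← e]; simp)
  · exact Or.inr (Or.inl (by rw [← e]; simp))
  · exact Or.inr (Or.inr (by rw [← e]; simp))

/-- In a locked pair against a side with a vertex of degree one and a vertex of degree two, the
other (eight-face) side is a solid triangle. -/
theorem solid_of_clash {h : ℕ} (u w : Fin 8 → Finset (Fin h)) (hw : Function.Injective w)
    (hlw : IsLowerSet (Set.range w))
    (hclash : ∀ (a c : Fin h), (Finset.univ.filter fun i => a ∈ u i).card ≠
      (Finset.univ.filter fun j => c ∈ w j).card)
    (p x : Fin h) (hp : (Finset.univ.filter fun i => p ∈ u i).card = 2)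
    (hx : (Finset.univ.filter fun i => x ∈ u i).card = 1) :
    ∃ a b c : Fin h, a ≠ b ∧ a ≠ c ∧ b ≠ c ∧ ∀ j, w j ⊆ {a, b, c} := by
  classical
  obtain ⟨hlow, hcard, hdegeq⟩ := image_lowerFamily w hw hlw
  obtain ⟨a, b, c, hab, hac, hbc, hall⟩ := lowerFamily_eight_no_degree_one_two _ hlow hcard
    (fun c hc => hclash x c (by rw [hx, ← hdegeq, hc]))
    (fun c hc => hclash p c (by rw [hp, ← hdegeq, hc]))
  exact ⟨a, b, c, hab, hac, hbc, fun j => hall _ (Finset.mem_image.mpr ⟨j, Finset.mem_univ _, rfl⟩)⟩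

/-! ## 2. Cell (6, 8): the claw plus an edge against the solid triangle -/

/-- **Cell `(6, 8)`.** -/
theorem good_clawEdge_h6_r8 (u w : Fin 8 → Finset (Fin 6)) (hu : Function.Injective u)
    (hw : Function.Injective w) (hlu : IsLowerSet (Set.range u)) (hlw : IsLowerSet (Set.range w))
    (hfull : ∀ a : Fin 6, ∃ i, a ∈ u i)
    (hclash : ∀ (a c : Fin 6), (Finset.univ.filter fun i => a ∈ u i).card ≠
      (Finset.univ.filter fun j => c ∈ w j).card) :
    ∃ H : Matrix (Fin (6 + 6)) (Fin (6 + 6)) ℂ, (Matrix.of fun i j : Fin 8 => (H.submatrix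
      (fun a : Fin 6 => if a ∈ u i then Fin.castAdd 6 a else Fin.natAdd 6 a)
      (fun c : Fin 6 => if c ∈ w j then Fin.natAdd 6 c else Fin.castAdd 6 c)).det).det ≠ 0 := by
  classical
  have hle2 : ∀ i, (u i).card ≤ 2 :=
    face_card_le_two_of_full u hlu hfull (by norm_num) (by norm_num) (by norm_num)
  obtain ⟨p, q, hpq, himg⟩ := image_eq_of_claw_edge_of_le_two u hu hlu hfull rfl hle2
  have hdegu := degree_of_claw_edge u hu {p, q} (Finset.card_pair hpq) himg
  -- a vertex off the edge
  obtain ⟨x, hx⟩ : ∃ x : Fin 6, x ∉ ({p, q} : Finset (Fin 6)) := by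
    by_contra hno
    push Not at hno
    have : (Finset.univ : Finset (Fin 6)) ⊆ {p, q} := fun x _ => hno x
    have := Finset.card_le_card this
    rw [Finset.card_univ, Fintype.card_fin, Finset.card_pair hpq] at this
    omega
  have hdp : (Finset.univ.filter fun i => p ∈ u i).card = 2 := by rw [hdegu p]; simp
  have hdx : (Finset.univ.filter fun i => x ∈ u i).card = 1 := by rw [hdegu x]; simp [hx]
  obtain ⟨a, b, c, hab, hac, hbc, hall⟩ := solid_of_clash u w hw hlw hclash p x hdp hdx
  -- relabelings
  obtain ⟨π, hπ⟩ := Equiv.Perm.exists_extending_pair (![p, q] : Fin 2 → Fin 6)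
    (![0, 1] : Fin 2 → Fin 6) (vec2_injective p q hpq) (by decide)
  have hπp : π p = 0 := hπ 0
  have hπq : π q = 1 := hπ 1
  obtain ⟨π', hπ'⟩ := Equiv.Perm.exists_extending_pair (![a, b, c] : Fin 3 → Fin 6)
    (![0, 1, 2] : Fin 3 → Fin 6) (vec3_injective a b c hab hac hbc) (by decide)
  have hπa : π' a = 0 := hπ' 0
  have hπb : π' b = 1 := hπ' 1
  have hπc : π' c = 2 := hπ' 2
  refine good_of_ppDerivable_relabel u w _ _ hu hw π π' ?_ ?_ claw6edge_v_simplex_h6_derivable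
  · intro i
    have hi : u i ∈ Finset.univ.image u := Finset.mem_image.mpr ⟨i, Finset.mem_univ _, rfl⟩
    rw [himg, Finset.mem_insert, Finset.mem_insert, Finset.mem_image] at hi
    rcases hi with e | e | ⟨y, _, e⟩
    · rw [e]; exact ⟨7, by simp [Finset.map_insert, hπp, hπq]⟩
    · rw [e]; exact ⟨0, by simp⟩
    · rw [← e, Finset.map_singleton]
      exact (by decide : ∀ z : Fin 6, ∃ i' : Fin 8, ({z} : Finset (Fin 6)) =
        (![∅, {0}, {1}, {2}, {3}, {4}, {5}, {0, 1}] : Fin 8 → Finset (Fin 6)) i') (π y)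
  · intro j
    have hz : (w j).map π'.toEmbedding ∈ (({0, 1, 2} : Finset (Fin 6))).powerset := by
      rw [Finset.mem_powerset]
      have := map_subset_three (w j) a b c π' (hall j)
      rwa [hπa, hπb, hπc] at this
    exact (by decide : ∀ z ∈ (({0, 1, 2} : Finset (Fin 6))).powerset, ∃ j' : Fin 8,
      z = (![∅, {0}, {1}, {2}, {0, 1}, {0, 2}, {1, 2}, {0, 1, 2}] : Fin 8 → Finset (Fin 6)) j') _ hz

/-! ## 3. Cell (5, 8): the claw plus two edges against the solid triangle -/

/-- **Cell `(5, 8)`.** -/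
theorem good_twoEdges_h5_r8 (u w : Fin 8 → Finset (Fin 5)) (hu : Function.Injective u)
    (hw : Function.Injective w) (hlu : IsLowerSet (Set.range u)) (hlw : IsLowerSet (Set.range w))
    (hfull : ∀ a : Fin 5, ∃ i, a ∈ u i)
    (hclash : ∀ (a c : Fin 5), (Finset.univ.filter fun i => a ∈ u i).card ≠
      (Finset.univ.filter fun j => c ∈ w j).card) :
    ∃ H : Matrix (Fin (5 + 5)) (Fin (5 + 5)) ℂ, (Matrix.of fun i j : Fin 8 => (H.submatrix
      (fun a : Fin 5 => if a ∈ u i then Fin.castAdd 5 a else Fin.natAdd 5 a)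
      (fun c : Fin 5 => if c ∈ w j then Fin.natAdd 5 c else Fin.castAdd 5 c)).det).det ≠ 0 := by
  classical
  have hle2 : ∀ i, (u i).card ≤ 2 :=
    face_card_le_two_of_full u hlu hfull (by norm_num) (by norm_num) (by norm_num)
  obtain ⟨e₁, e₂, hne, h1, h2, himg⟩ := image_eq_of_claw_two_edges_of_le_two u hu hlu hfull rfl hle2
  have hdegu := degree_of_claw_two_edges u hu e₁ e₂ hne h1 h2 himg
  -- a coordinate outside both edges (degree one)
  obtain ⟨x, hx⟩ : ∃ x : Fin 5, x ∉ e₁ ∪ e₂ := by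
    by_contra hno
    push Not at hno
    have : (Finset.univ : Finset (Fin 5)) ⊆ e₁ ∪ e₂ := fun x _ => hno x
    have := (Finset.card_le_card this).trans (Finset.card_union_le _ _)
    rw [Finset.card_univ, Fintype.card_fin, h1, h2] at this
    omega
  rw [Finset.mem_union, not_or] at hx
  have hdx : (Finset.univ.filter fun i => x ∈ u i).card = 1 := by rw [hdegu x]; simp [hx.1, hx.2]
  -- columns relabeling target
  have hcols : ∀ (a b c : Fin 5), a ≠ b → a ≠ c → b ≠ c → (∀ j, w j ⊆ {a, b, c}) →
      ∃ π' : Equiv.Perm (Fin 5), ∀ j, ∃ j', (w j).map π'.toEmbedding =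
        (![∅, {0}, {1}, {2}, {0, 1}, {0, 2}, {1, 2}, {0, 1, 2}] : Fin 8 → Finset (Fin 5)) j' := by
    intro a b c hab hac hbc hall
    obtain ⟨π', hπ'⟩ := Equiv.Perm.exists_extending_pair (![a, b, c] : Fin 3 → Fin 5)
      (![0, 1, 2] : Fin 3 → Fin 5) (vec3_injective a b c hab hac hbc) (by decide)
    have hπa : π' a = 0 := hπ' 0
    have hπb : π' b = 1 := hπ' 1
    have hπc : π' c = 2 := hπ' 2
    refine ⟨π', fun j => ?_⟩
    have hz : (w j).map π'.toEmbedding ∈ (({0, 1, 2} : Finset (Fin 5))).powerset := by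
      rw [Finset.mem_powerset]
      have := map_subset_three (w j) a b c π' (hall j)
      rwa [hπa, hπb, hπc] at this
    exact (by decide : ∀ z ∈ (({0, 1, 2} : Finset (Fin 5))).powerset, ∃ j' : Fin 8,
      z = (![∅, {0}, {1}, {2}, {0, 1}, {0, 2}, {1, 2}, {0, 1, 2}] : Fin 8 → Finset (Fin 5)) j') _ hz
  -- rows: a singleton relabels to a singleton
  have hsing : ∀ (π : Equiv.Perm (Fin 5)) (y : Fin 5) (t : Finset (Fin 5)),
      (∃ i' : Fin 8, ({π y} : Finset (Fin 5)) =
        (![∅, {0}, {1}, {2}, {3}, {4}, {0, 1}, t] : Fin 8 → Finset (Fin 5)) i') := by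
    intro π y t
    have : ∀ z : Fin 5, ∃ i' : Fin 6, ({z} : Finset (Fin 5)) =
        (![∅, {0}, {1}, {2}, {3}, {4}] : Fin 6 → Finset (Fin 5)) i' := by decide
    obtain ⟨i', hi'⟩ := this (π y)
    refine ⟨i'.castLE (by norm_num), ?_⟩
    rw [hi']
    fin_cases i' <;> rfl
  by_cases hdisj : Disjoint e₁ e₂
  · -- matching plus a point
    obtain ⟨p, q, hpq, rfl⟩ := Finset.card_eq_two.mp h1
    obtain ⟨s, t, hst, rfl⟩ := Finset.card_eq_two.mp h2
    have hps : p ≠ s := fun e => Finset.disjoint_left.mp hdisj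
      (show p ∈ ({p, q} : Finset (Fin 5)) by simp) (show p ∈ ({s, t} : Finset (Fin 5)) by simp [e])
    have hpt : p ≠ t := fun e => Finset.disjoint_left.mp hdisj
      (show p ∈ ({p, q} : Finset (Fin 5)) by simp) (show p ∈ ({s, t} : Finset (Fin 5)) by simp [e])
    have hqs : q ≠ s := fun e => Finset.disjoint_left.mp hdisj
      (show q ∈ ({p, q} : Finset (Fin 5)) by simp) (show q ∈ ({s, t} : Finset (Fin 5)) by simp [e])
    have hqt : q ≠ t := fun e => Finset.disjoint_left.mp hdisj
      (show q ∈ ({p, q} : Finset (Fin 5)) by simp) (show q ∈ ({s, t} : Finset (Fin 5)) by simp [e])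
    have hdp : (Finset.univ.filter fun i => p ∈ u i).card = 2 := by rw [hdegu p]; simp [hps, hpt]
    obtain ⟨a, b, c, hab, hac, hbc, hall⟩ := solid_of_clash u w hw hlw hclash p x hdp hdx
    obtain ⟨π', hπ'⟩ := hcols a b c hab hac hbc hall
    obtain ⟨π, hπ⟩ := Equiv.Perm.exists_extending_pair (![p, q, s, t] : Fin 4 → Fin 5)
      (![0, 1, 2, 3] : Fin 4 → Fin 5) (vec4_injective p q s t hpq hps hpt hqs hqt hst) (by decide)
    have hπp : π p = 0 := hπ 0
    have hπq : π q = 1 := hπ 1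
    have hπs : π s = 2 := hπ 2
    have hπt : π t = 3 := hπ 3
    refine good_of_ppDerivable_relabel u w _ _ hu hw π π' ?_ hπ' matching5_v_simplex_h5_derivable
    intro i
    have hi : u i ∈ Finset.univ.image u := Finset.mem_image.mpr ⟨i, Finset.mem_univ _, rfl⟩
    rw [himg, Finset.mem_insert, Finset.mem_insert, Finset.mem_insert, Finset.mem_image] at hi
    rcases hi with e | e | e | ⟨y, _, e⟩
    · rw [e]; exact ⟨6, by simp [Finset.map_insert, hπp, hπq]⟩
    · rw [e]; exact ⟨7, by simp [Finset.map_insert, hπs, hπt]⟩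
    · rw [e]; exact ⟨0, by simp⟩
    · rw [← e, Finset.map_singleton]
      exact hsing π y {2, 3}
  · -- two edges through a common vertex
    obtain ⟨v, hv1, hv2⟩ : ∃ v, v ∈ e₁ ∧ v ∈ e₂ := Finset.not_disjoint_iff.mp hdisj
    obtain ⟨q, hq⟩ := Finset.card_eq_one.mp
      (show (e₁.erase v).card = 1 by rw [Finset.card_erase_of_mem hv1, h1])
    obtain ⟨s, hs⟩ := Finset.card_eq_one.mp
      (show (e₂.erase v).card = 1 by rw [Finset.card_erase_of_mem hv2, h2])
    have hqe : q ∈ e₁.erase v := by rw [hq]; simp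
    have hse : s ∈ e₂.erase v := by rw [hs]; simp
    obtain ⟨hqv, hq1⟩ := Finset.mem_erase.mp hqe
    obtain ⟨hsv, hs2⟩ := Finset.mem_erase.mp hse
    have he1 : e₁ = {v, q} := by rw [← Finset.insert_erase hv1, hq]
    have he2 : e₂ = {v, s} := by rw [← Finset.insert_erase hv2, hs]
    have hqs : q ≠ s := fun e => hne (by rw [he1, he2, e])
    have hq2 : q ∉ e₂ := by
      rw [he2]; simp only [Finset.mem_insert, Finset.mem_singleton, not_or]; exact ⟨hqv, hqs⟩
    have hdq : (Finset.univ.filter fun i => q ∈ u i).card = 2 := by rw [hdegu q]; simp [hq1, hq2]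
    obtain ⟨a, b, c, hab, hac, hbc, hall⟩ := solid_of_clash u w hw hlw hclash q x hdq hdx
    obtain ⟨π', hπ'⟩ := hcols a b c hab hac hbc hall
    obtain ⟨π, hπ⟩ := Equiv.Perm.exists_extending_pair (![v, q, s] : Fin 3 → Fin 5)
      (![0, 1, 2] : Fin 3 → Fin 5) (vec3_injective v q s hqv.symm hsv.symm hqs) (by decide)
    have hπv : π v = 0 := hπ 0
    have hπq : π q = 1 := hπ 1
    have hπs : π s = 2 := hπ 2
    refine good_of_ppDerivable_relabel u w _ _ hu hw π π' ?_ hπ' path3at5_v_simplex_h5_derivable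
    intro i
    have hi : u i ∈ Finset.univ.image u := Finset.mem_image.mpr ⟨i, Finset.mem_univ _, rfl⟩
    rw [himg, Finset.mem_insert, Finset.mem_insert, Finset.mem_insert, Finset.mem_image] at hi
    rcases hi with e | e | e | ⟨y, _, e⟩
    · rw [e, he1]; exact ⟨6, by simp [Finset.map_insert, hπv, hπq]⟩
    · rw [e, he2]; exact ⟨7, by simp [Finset.map_insert, hπv, hπs]⟩
    · rw [e]; exact ⟨0, by simp⟩
    · rw [← e, Finset.map_singleton]
      exact hsing π y {0, 2}

end Summit.ValiantsHypothesis.ValiantsHypothesis.Theorems.BarrierLever.FiniteCheck
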